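import Literature.MathematicalPhysics.QuantumFieldTheory.Balaban1983to89.B13OpsYPencilGreenPrime
import Literature.Computability.QuantumComplexity.SolovayKitaev.Basic

/-!
# `Balaban1983to89.B13MatrixUnitBasisNumerals` — T. Bałaban, *Propagators for lattice gauge theories in a background field*, Commun. Math. Phys. **99**
(1985) 389–434 [Balaban1985BackgroundPropagators], p. 389 («gauge field A with values in the Lie algebra 𝔤» ⊂ `M_N(ℂ)`), (3.107)–(3.108) p. 416 (kernels
`G(x,x′)` of operators on `𝔤`-valued lattice functions); *Renormalization group approach to lattice gauge field theories. II*, Commun. Math. Phys. **116**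
(1988) 1–22 [Balaban1988RG2Cluster] (2.5)–(2.7) pp. 12–13: THE TWO BASIS NUMERALS OF THE RECORD's LETTER ALGEBRA — for `𝔸 = M_N(ℂ)` with NODE 00's norm of
record (the L²-operator ∕ C⋆ norm, `Matrix.Norms.L2Operator`, as in `Node00.lettersYOfRecord`) and the matrix-unit basis `Matrix.stdBasis ℂ n n`
(`(i,j) ↦ E_{ij}`): `cl = 1` (`‖E_{ij}‖ ≤ 1`) and `cb = 1` (`|a_{ij}| ≤ ‖a‖`) — the located values of the basis binders `hcb ∕ hcl` displayed by
`B13InverseOperatorCoordinates` §5 and `B13OpsYPencilGreenPrime` §3–§4; and THE G′-JUNCTION AT THE RECORD's ALGEBRA with both discharged.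

statement-level bookkeeping ([folklore] linear algebra: an entry and a matrix unit are bounded by ∕ bound the operator norm) over Mathlib's
`Matrix.l2_opNorm_mulVec`, `PiLp.norm_single`, `PiLp.norm_apply_le`, `Matrix.stdBasis_eq_single` and the tree's `SolovayKitaev.norm_apply_le_norm`; kernel-checked; THEOREMS ONLY; nothing here is a claim
about the Yang–Mills mass gap; nothing of Bałaban's is constructed or asserted; no node is discharged; count-neutral.

WHY THIS FILE (cell `pub-ymgap`, HUMAN RULING D-0062 ∕ D-0149, Track A node N10 = [B13]; width seat `pub-ymgap-dag-n10-w2` g2, INTENT-6, the inverse road at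
NODE 00's objects).  The inverse reader (p599011 ∕ p601656) and the G′-junction (`B13OpsYPencilGreenPrime`) carry two numerals of the chosen ℂ-basis `b` of
`𝔸`: `hcb : ‖b.repr a k‖ ≤ cb·‖a‖` and `hcl : ‖b_l‖ ≤ cl`.  At the record (`𝔸 = M_N(ℂ)`, L²-operator norm, matrix units) both are `1`:
* §1 (any finite index type `n`): `|a_{ij}| ≤ ‖a‖` is the tree's `SolovayKitaev.norm_apply_le_norm` (CITED, not restated — gate dedup); `l2_opNorm_single_one_le` (`‖E_{ij}‖ ≤ 1`), `stdBasis_repr_apply`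
  (`(stdBasis).repr a (i,j) = a_{ij}`), ★ `norm_stdBasis_repr_le` (`hcb` with `cb = 1`), ★ `norm_stdBasis_le_one` (`hcl` with `cl = 1`).
* §2 ★★★ `rawEntryLetters_toMatrix_GpY_prodCfg_of_pencil_record` — `B13OpsYPencilGreenPrime.rawEntryLetters_toMatrix_GpY_prodCfg_of_pencil` AT `𝔸 := M_N(ℂ)`
  (`N ≥ 1`), `b :=` the matrix units, `cb = cl = 1`: NODE 00's `G′(e^{iηA′}U₀)` in N10 coordinates along pv27's pencil at the located thin radius, displaying
  ONLY N06's `IsUnit (Δ′_a(U₀))` + the pointwise (3.108)-type bound for `G′(U₀)` at ONE real background, NODE 00's numerals `K₀, D, Cavg, s`, a fibre bound,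
  `0 < Rc` — no basis binder left.
HONEST FRAMING: located numerals; which `N`, `ℓ`, `U₀`, `η` are «of record» is NODE 00's ∕ def-Y's ∕ def-T's word; Theorem 3.1 ∕ 3.10 at the centre stays
N06's displayed content (GAPS G-B9-05∕06a∕07); nothing of Bałaban's asserted; N06 ∕ N10 NOT discharged; K1⁷ NOT closed; counts unmoved (typed 28∕28 ·
discharged 5∕27); 0 `def`, 0 `sorry`, standard axioms; one finite 𝕋⁴ programme at fixed ε — R4 closes the conditional finite-𝕋⁴ rung `BalabanLadder.UV`
only; the YM mass gap (Clay) is NOT proved by any of this; nothing continuum ∕ ℝ⁴ ∕ OS.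

References: T. Bałaban, CMP 99 (1985) 389–434 [Balaban1985BackgroundPropagators] p.389, (3.24)–(3.25) pp.394–395, Thm 3.1 (3.42) p.397, Thm 3.4 p.400,
(3.60)–(3.65) p.402, Thm 3.10 (3.107)–(3.108) pp.415–416; CMP 116 (1988) 1–22 [Balaban1988RG2Cluster] (2.5)–(2.7) pp.12–13, p.15.
-/

noncomputable section

namespace Literature.MathematicalPhysics.QuantumFieldTheory.Balaban1983to89.B13MatrixUnitBasisNumerals

open Metric Set Finset Module WithLp
open scoped Matrix Matrix.Norms.L2Operator
open Literature.MathematicalPhysics.QuantumFieldTheory.Balaban1983to89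
open Literature.MathematicalPhysics.QuantumFieldTheory.Balaban1983to89.B9Thm37GlueTorus (tdist1)
open Literature.MathematicalPhysics.QuantumFieldTheory.Balaban1983to89.B5TorusCover (UT)
open Literature.MathematicalPhysics.QuantumFieldTheory.Balaban1983to89.B13EntrywiseWalks (RawEntryLetters)
open Literature.MathematicalPhysics.QuantumFieldTheory.Balaban1983to89.B13OpsYPencilGreenPrime (rawEntryLetters_toMatrix_GpY_prodCfg_of_pencil)
open Literature.MathematicalPhysics.QuantumFieldTheory.Balaban1983to89.B9Eq39Adjoint (prodCfg)
open Literature.MathematicalPhysics.QuantumFieldTheory.Balaban1983to89.B6GlobalChartV1 (PV boxEquiv)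
open Literature.MathematicalPhysics.QuantumFieldTheory.Balaban1983to89.B6KLevelCensusIndexV1 (KIdx)
open Literature.MathematicalPhysics.QuantumFieldTheory.Balaban1983to89.Node00

/-! ## §1. The matrix units of `M_n(ℂ)` under the L²-operator norm: `cb = cl = 1` -/

section Numerals

variable {n : Type} [Fintype n] [DecidableEq n]

/-- **A MATRIX UNIT HAS OPERATOR NORM AT MOST ONE**: `‖E_{ij}‖ ≤ 1` (`E_{ij}x = x_j e_i`). [folklore]
[cite: Balaban1985BackgroundPropagators, p.389 («values in the Lie algebra 𝔤»), dictionary] -/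
theorem l2_opNorm_single_one_le (i j : n) : ‖(Matrix.single i j (1 : ℂ) : Matrix n n ℂ)‖ ≤ 1 := by
  rw [Matrix.cstar_norm_def]
  refine ContinuousLinearMap.opNorm_le_bound _ zero_le_one fun x => ?_
  rw [one_mul]
  have h : Matrix.toEuclideanCLM (n := n) (𝕜 := ℂ) (Matrix.single i j (1 : ℂ)) x = EuclideanSpace.single i (x j) := by
    apply WithLp.ofLp_injective (p := 2)
    rw [Matrix.ofLp_toEuclideanCLM, Matrix.single_mulVec]
    ext k
    simp [EuclideanSpace.single, Function.update_apply, eq_comm]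
  rw [h, EuclideanSpace.single, PiLp.norm_single]
  exact PiLp.norm_apply_le x j

omit [DecidableEq n] in
/-- The matrix-unit basis' coordinates are the entries. [folklore] [cite: Balaban1985BackgroundPropagators, (3.107) p.416, dictionary] -/
theorem stdBasis_repr_apply (A : Matrix n n ℂ) (i j : n) : (Matrix.stdBasis ℂ n n).repr A (i, j) = A i j := by
  simp [Matrix.stdBasis]

/-- ★ **`cb = 1`**: the binder `hcb` of `B13InverseOperatorCoordinates` §5 ∕ `B13OpsYPencilGreenPrime` at the matrix units of `M_n(ℂ)`:
`‖(stdBasis).repr a p‖ ≤ 1·‖a‖`. [folklore] [cite: Balaban1985BackgroundPropagators, (3.108) p.416, dictionary] -/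
theorem norm_stdBasis_repr_le (A : Matrix n n ℂ) (p : n × n) : ‖(Matrix.stdBasis ℂ n n).repr A p‖ ≤ 1 * ‖A‖ := by
  obtain ⟨i, j⟩ := p
  rw [stdBasis_repr_apply, one_mul]
  exact Literature.Computability.QuantumComplexity.SolovayKitaev.norm_apply_le_norm A i j

/-- ★ **`cl = 1`**: the binder `hcl` at the matrix units: `‖(stdBasis) p‖ ≤ 1`. [folklore] [cite: Balaban1985BackgroundPropagators, p.389, dictionary] -/
theorem norm_stdBasis_le_one (p : n × n) : ‖Matrix.stdBasis ℂ n n p‖ ≤ 1 := by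
  obtain ⟨i, j⟩ := p
  rw [Matrix.stdBasis_eq_single]
  exact l2_opNorm_single_one_le i j

end Numerals

/-! ## §2. ★★★ The G′-junction at the record's letter algebra `M_N(ℂ)` — no basis binder left -/

section Record

variable {N : ℕ} [NeZero N]
variable {d ℓ : ℕ} {hd : 1 ≤ d + 1} {hL : Odd (ℓ + 1) ∧ 1 < ℓ + 1} {b₀ b₁ : ℝ}
variable (i : KIdx d ℓ hd hL b₀ b₁)
variable {ν : ℕ} {Nf : Fin ν → ℕ} [∀ j, NeZero (Nf j)]

/-- ★★★ **`G′(e^{iηA′}U₀)` IN N10 COORDINATES AT THE RECORD's ALGEBRA** (`𝔸 = M_N(ℂ)`, `N ≥ 1`, L²-operator norm, matrix-unit coordinates; `cb = cl = 1` by §1):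
`RawEntryLetters (A′ ↦ toMatrix B′ B′ (G′(e^{iηA′}U₀))) (ℓ ∘ fst) R₁⋆ ρ′ (2·B_G)` along pv27's pencil, for every `0 ≤ ρ′ < ρ`, displaying ONLY: N06's `IsUnit (Δ′_a(U₀))` and
the pointwise (3.108)-type bound `‖G′(U₀)(δ_x ⊗ E)(y)‖ ≤ B_G‖E‖e^{−ρ d(ℓy,ℓx)}` at the ONE real background (Thm 3.1 ∕ 3.10); NODE 00's numerals `K₀` (background size),
`D`, `Cavg` (averaging support ∕ row sum), `s` (reading); a fibre bound `m` of `ℓ`; `0 < Rc`.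
[cite: Balaban1985BackgroundPropagators, (3.24)–(3.25) pp.394–395, Thm 3.1 (3.42) p.397, Thm 3.4 p.400, (3.60)–(3.65) p.402, Thm 3.10 (3.107)–(3.108) p.416;
Balaban1988RG2Cluster, (2.5)–(2.7) pp.12–13, p.15] -/
theorem rawEntryLetters_toMatrix_GpY_prodCfg_of_pencil_record
    (U₀ : CfgY (Matrix (Fin N) (Fin N) ℂ) i) (η : ℝ) {Rc K₀ : ℝ} {D : ℕ}
    (hU : ∀ μ x, ‖(U₀ μ x : Matrix (Fin N) (Fin N) ℂ)‖ ≤ K₀)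
    (hUi : ∀ μ x, ‖(((U₀ μ x)⁻¹ : (Matrix (Fin N) (Fin N) ℂ)ˣ) : Matrix (Fin N) (Fin N) ℂ)‖ ≤ K₀) (hK1 : 1 ≤ K₀) (hRc : 0 < Rc)
    (hD : ∀ z w, avgCoeffY i z w ≠ 0 →
      Site.tdist ((boxEquiv i.hN).symm z) ((boxEquiv i.hN).symm (cornerY i (levY i z) z)) +
        Site.tdist ((boxEquiv i.hN).symm (cornerY i (levY i z) z)) ((boxEquiv i.hN).symm w) ≤ D)
    {Cavg : ℝ} (hCavg0 : 0 ≤ Cavg) (hCavg : ∀ z, ∑ w, |avgCoeffY i z w| ≤ Cavg)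
    (ℓ' : SiteY i → UT Nf) {s : ℝ} (hs0 : 0 ≤ s)
    (hℓ : ∀ μ z, tdist1 Nf (ℓ' (shiftY i μ z)) (ℓ' z) ≤ s) (hℓa : ∀ z w, avgCoeffY i z w ≠ 0 → tdist1 Nf (ℓ' z) (ℓ' w) ≤ s)
    {m : ℕ} (hfib : ∀ y : UT Nf, (univ.filter fun p : SiteY i × (Fin N × Fin N) => ℓ' p.1 = y).card ≤ m)
    (hunit : IsUnit (deltaPrimeAY i (parSY i) U₀)) {BG ρ : ℝ} (hBG : 0 ≤ BG) (hρ : 0 ≤ ρ)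
    (hO : ∀ x y (E : Matrix (Fin N) (Fin N) ℂ),
      ‖GpY i (parSY i) U₀ (Pi.single x E) y‖ ≤ BG * ‖E‖ * Real.exp (-(ρ * tdist1 Nf (ℓ' y) (ℓ' x))))
    {ρ' : ℝ} (hρ'0 : 0 ≤ ρ') (hρ' : ρ' < ρ) :
    RawEntryLetters (fun a : Fin (d + 1) → Site (PV d ℓ i.m i.K hd hL) 0 → Matrix (Fin N) (Fin N) ℂ =>
        LinearMap.toMatrix
          ((Pi.basis fun _ : SiteY i => Matrix.stdBasis ℂ (Fin N) (Fin N)).reindex (Equiv.sigmaEquivProd (SiteY i) (Fin N × Fin N)))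
          ((Pi.basis fun _ : SiteY i => Matrix.stdBasis ℂ (Fin N) (Fin N)).reindex (Equiv.sigmaEquivProd (SiteY i) (Fin N × Fin N)))
          (GpY i (parSY i) (prodCfg U₀ η a)))
      (fun p : SiteY i × (Fin N × Fin N) => ℓ' p.1)
      (Rc / (4 * ((1 * (((d : ℝ) + 1) *
          (K₀ * Real.exp (|η| * Rc) * (K₀ * Real.exp (|η| * Rc) * 1 * (K₀ * Real.exp (|η| * Rc)) + 1) * (K₀ * Real.exp (|η| * Rc)) +
            (K₀ * Real.exp (|η| * Rc) * 1 * (K₀ * Real.exp (|η| * Rc)) + 1)) +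
          Cavg * ((K₀ * Real.exp (|η| * Rc)) ^ D * 1 * (K₀ * Real.exp (|η| * Rc)) ^ D)) * Real.exp (ρ * s)) *
          (1 * 1 * BG) * (m * B6.c0 1 ((ρ - ρ') / 3) ^ ν) * (m * B6.c0 1 ((ρ - ρ') / 3) ^ ν)) + 1))
      ρ' (2 * (1 * 1 * BG)) :=
  rawEntryLetters_toMatrix_GpY_prodCfg_of_pencil i (Matrix.stdBasis ℂ (Fin N) (Fin N)) U₀ η hU hUi hK1 hRc hD hCavg0 hCavg
    (norm_stdBasis_repr_le) zero_le_one (norm_stdBasis_le_one) zero_le_one ℓ' hs0 hℓ hℓa hfib hunit hBG hρ hO hρ'0 hρ'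

end Record

end Literature.MathematicalPhysics.QuantumFieldTheory.Balaban1983to89.B13MatrixUnitBasisNumerals

end
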